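import Literature.Geometry.Riemannian.GradientShrinkerProofs
import HarnessLib

/-!
# Jensen volume bound `∫ e^{-f} dV ≤ e^{-2} Vol(M,g)` on a closed normalised 4-d gradient shrinker
(stub `stub_jensenVolumeBound` of line `cgy-variance-pivot`, crux `EntropyRung.CompactShrinkerGap`,
item stmt-SmoothPoincare4-10870)

For a Riemannian metric `g` (Levi-Civita connection) on a closed `4`-manifold and a smooth `f`
with `Ric + Hess f = g/2` and `R + |∇f|² = f` (a normalised gradient shrinker, `τ = 1`):

* `integral_mul_exp_neg_eq_two_mul`: `∫ f e^{-f} dV = 2 ∫ e^{-f} dV` — the integrated form of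
  `Δ(e^{-f}) = (f − n/2) e^{-f}` (`IsNormalisedShrinker.dalembertian_exp_neg`, Carrillo–Ni 2009,
  §2 (2.1)–(2.3) and §4) with `n = finrank ℝ ℝ⁴ = 4` and `∫ Δu dV = 0` on a closed manifold
  (`integral_dalembertian_riemVolume_eq_zero`);
* `stub_jensenVolumeBound` (the registered stub): `∫ e^{-f} dV ≤ e^{-2} Vol(M,g)`, from the
  previous identity and the tangent line `(t − 1)e^{-t} ≤ e^{-2}`:
  `∫ e^{-f} = ∫ (f − 1) e^{-f} ≤ e^{-2} Vol` (equality iff `f ≡ 2`, the Einstein case; this is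
  the statement "`S⁴` maximises `Θ` among Einstein shrinkers of the same volume" behind the
  Cao–Hamilton–Ilmanen table, §4);
* `volume_floor_of_density`: with the crux's density hypothesis
  `32π²√π e^{-3/2} < ∫⁻ e^{-f} dV` (its `lintegral` form) the volume obeys
  `32π²√π e^{1/2} < Vol(M,g)`.

The measure-theoretic cores (`sub_one_mul_exp_neg_le_exp_neg_two`,
`integral_exp_neg_le_of_mean_two`, `volume_floor_of_mean_two`) are stated for an arbitrary finite
measure. Everything is proved; no definition, no named fact.

References: H.-D. Cao, R. S. Hamilton, T. Ilmanen, arXiv:math/0404165, §§3–4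
[CaoHamiltonIlmanen2004]; J. A. Carrillo, L. Ni, Comm. Anal. Geom. 17 (2009), §2 and §4
[CarrilloNi2009]; J. M. Lee, *Introduction to Riemannian Manifolds* (2018), Problem 2-23 [Lee2018].
-/

noncomputable section

-- the registered namespace `Summit.SmoothPoincare4.SmoothPoincare4.Theorems` repeats a component
set_option linter.dupNamespace false

open Bundle Set Function Filter Module MeasureTheory
open scoped Manifold ContDiff Topology ENNReal

namespace Summit.SmoothPoincare4.SmoothPoincare4.Theorems

open Literature.Geometry Literature.Geometry.Lorentzian Literature.Geometry.Riemannian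
  Literature.Geometry.Lorentzian.PseudoRiemannianMetric

/-! ## The measure-theoretic core (any finite measure) -/

/-- **Tangent-line inequality** behind the Jensen volume bound: `(t − 1) e^{-t} ≤ e^{-2}` for
every real `t`, with equality at `t = 2` (from `1 + x ≤ eˣ` at `x = t − 2`). [folklore] -/
theorem sub_one_mul_exp_neg_le_exp_neg_two (t : ℝ) : (t - 1) * Real.exp (-t) ≤ Real.exp (-2) := by
  have h1 : t - 2 + 1 ≤ Real.exp (t - 2) := Real.add_one_le_exp (t - 2)
  have h2 : 0 < Real.exp (-t) := Real.exp_pos _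
  calc (t - 1) * Real.exp (-t) ≤ Real.exp (t - 2) * Real.exp (-t) := by
        apply mul_le_mul_of_nonneg_right _ h2.le
        linarith
    _ = Real.exp (-2) := by
        rw [← Real.exp_add]
        ring_nf

/-- **Jensen volume bound, measure-theoretic core**: on a finite measure space, if `e^{-f}` and
`f e^{-f}` are integrable and `∫ f e^{-f} dμ = 2 ∫ e^{-f} dμ` (the integrated shrinker identity
of a closed normalised 4-d gradient shrinker), then `∫ e^{-f} dμ ≤ e^{-2} μ(univ)`:
`∫ e^{-f} = ∫ (f − 1) e^{-f} ≤ ∫ e^{-2}` by the tangent line `(t − 1)e^{-t} ≤ e^{-2}`.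
[cite: CaoHamiltonIlmanen2004, §4] -/
theorem integral_exp_neg_le_of_mean_two {α : Type*} [MeasurableSpace α] (μ : Measure α)
    [IsFiniteMeasure μ] (f : α → ℝ)
    (h₁ : Integrable (fun x ↦ Real.exp (-f x)) μ)
    (h₂ : Integrable (fun x ↦ f x * Real.exp (-f x)) μ)
    (hid : ∫ x, f x * Real.exp (-f x) ∂μ = 2 * ∫ x, Real.exp (-f x) ∂μ) :
    ∫ x, Real.exp (-f x) ∂μ ≤ Real.exp (-2) * (μ univ).toReal := by
  have hkey : ∫ x, Real.exp (-f x) ∂μ = ∫ x, (f x - 1) * Real.exp (-f x) ∂μ := by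
    have : (fun x ↦ (f x - 1) * Real.exp (-f x)) =
        fun x ↦ f x * Real.exp (-f x) - Real.exp (-f x) := by
      funext x
      ring
    rw [this, integral_sub h₂ h₁, hid]
    ring
  rw [hkey]
  calc ∫ x, (f x - 1) * Real.exp (-f x) ∂μ ≤ ∫ _, Real.exp (-2) ∂μ := by
        apply integral_mono ((h₂.sub h₁).congr _) (integrable_const _)
        · intro x
          exact sub_one_mul_exp_neg_le_exp_neg_two (f x)
        · exact ae_of_all _ fun x ↦ by simp only [Pi.sub_apply]; ring
    _ = Real.exp (-2) * (μ univ).toReal := by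
        rw [integral_const, smul_eq_mul, Measure.real]
        ring

/-- **Volume floor, measure-theoretic core**: under the same identity `∫ f e^{-f} = 2 ∫ e^{-f}`,
a density floor `32π²√π e^{-3/2} < ∫⁻ e^{-f} dμ` (in `lintegral` form) forces
`μ(univ) > 32π²√π e^{1/2}` (`≈ 922.9`), by `integral_exp_neg_le_of_mean_two` and
`e^{1/2} = e^{-3/2} · e²`. [cite: CaoHamiltonIlmanen2004, §4] -/
theorem volume_floor_of_mean_two {α : Type*} [MeasurableSpace α] (μ : Measure α)
    [IsFiniteMeasure μ] (f : α → ℝ)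
    (h₁ : Integrable (fun x ↦ Real.exp (-f x)) μ)
    (h₂ : Integrable (fun x ↦ f x * Real.exp (-f x)) μ)
    (hid : ∫ x, f x * Real.exp (-f x) ∂μ = 2 * ∫ x, Real.exp (-f x) ∂μ)
    (hdens : ENNReal.ofReal (32 * Real.pi ^ 2 * Real.sqrt Real.pi * Real.exp (-(3 : ℝ) / 2)) <
      ∫⁻ x, ENNReal.ofReal (Real.exp (-f x)) ∂μ) :
    32 * Real.pi ^ 2 * Real.sqrt Real.pi * Real.exp (1 / 2) < (μ univ).toReal := by
  have hJ := integral_exp_neg_le_of_mean_two μ f h₁ h₂ hid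
  rw [← ofReal_integral_eq_lintegral_ofReal h₁ (ae_of_all _ fun x ↦ (Real.exp_pos _).le),
    ENNReal.ofReal_lt_ofReal_iff'] at hdens
  have h3 : 32 * Real.pi ^ 2 * Real.sqrt Real.pi * Real.exp (-(3 : ℝ) / 2) <
      Real.exp (-2) * (μ univ).toReal :=
    hdens.1.trans_le hJ
  have h4 : Real.exp (1 / 2) = Real.exp (-(3 : ℝ) / 2) * Real.exp 2 := by
    rw [← Real.exp_add]
    norm_num
  have h5 : Real.exp (-2) * Real.exp 2 = 1 := by
    rw [← Real.exp_add]
    norm_num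
  calc 32 * Real.pi ^ 2 * Real.sqrt Real.pi * Real.exp (1 / 2)
      = (32 * Real.pi ^ 2 * Real.sqrt Real.pi * Real.exp (-(3 : ℝ) / 2)) * Real.exp 2 := by
        rw [h4]
        ring
    _ < (Real.exp (-2) * (μ univ).toReal) * Real.exp 2 :=
        mul_lt_mul_of_pos_right h3 (Real.exp_pos 2)
    _ = (μ univ).toReal := by
        rw [mul_comm (Real.exp (-2)), mul_assoc, h5, mul_one]

/-! ## The shrinker identity `∫ f e^{-f} dV = 2 ∫ e^{-f} dV` and its consequences -/

/-- **`∫ f e^{-f} dV = 2 ∫ e^{-f} dV` on a closed normalised four-dimensional gradient shrinker.**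
For `g` Riemannian (Levi-Civita) on a closed 4-manifold and `f` smooth with `Ric + Hess f = g/2`,
`R + |∇f|² = f`: `Δ(e^{-f}) = (f − n/2) e^{-f}` (`IsNormalisedShrinker.dalembertian_exp_neg`,
via `isNormalisedShrinker_one_iff`) with `n = finrank ℝ ℝ⁴ = 4`, and `∫ Δ(e^{-f}) dV = 0`
(`integral_dalembertian_riemVolume_eq_zero`, `riemVolume_eq`); both integrands are continuous on
a compact manifold of finite volume. [cite: CarrilloNi2009, §2 (2.1)–(2.3) and §4] -/
theorem integral_mul_exp_neg_eq_two_mul :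
    ∀ (M : Type) [TopologicalSpace M] [T2Space M] [SecondCountableTopology M]
      [ChartedSpace (EuclideanSpace ℝ (Fin 4)) M] [IsManifold (𝓡 4) ∞ M] [CompactSpace M]
      [T3Space M] [MeasurableSpace M] [BorelSpace M]
      (g : Literature.Geometry.Lorentzian.PseudoRiemannianMetric (𝓡 4) ∞ (EuclideanSpace ℝ (Fin 4))
        (TangentSpace (𝓡 4) : M → Type _)) [g.HasLeviCivita] (f : M → ℝ) (hg : g.IsRiemannian),
      ContMDiff (𝓡 4) 𝓘(ℝ, ℝ) ∞ f →
      (∀ (x : M) (X Y : TangentSpace (𝓡 4) x),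
        g.ricci x X Y + g.hessian f x X Y = (1 / 2 : ℝ) * g.val x X Y) →
      (∀ x : M, g.scalarCurvature x + g.gradSq f x = f x) →
      ∫ x, f x * Real.exp (-f x)
          ∂(Literature.Geometry.Lorentzian.riemannianMeasure (g.toContMDiffRiemannianMetric hg)) =
        2 * ∫ x, Real.exp (-f x)
          ∂(Literature.Geometry.Lorentzian.riemannianMeasure (g.toContMDiffRiemannianMetric hg)) := by
  intro M _ _ _ _ _ _ _ _ _ g _ f hg hf hsol hnorm
  have hV : g.riemVolume = riemannianMeasure (g.toContMDiffRiemannianMetric hg) :=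
    PseudoRiemannianMetric.riemVolume_eq hg
  rw [← hV]
  have hE : finrank ℝ (EuclideanSpace ℝ (Fin 4)) = 4 := finrank_euclideanSpace_fin
  -- the hypotheses say `(g, f, 1)` is a normalised gradient shrinker
  have h : g.IsNormalisedShrinker f 1 := (g.isNormalisedShrinker_one_iff f).2 ⟨hsol, hnorm⟩
  -- integrability of the (continuous) integrands for the finite measure `dV_g`
  have hint : Integrable (fun x ↦ Real.exp (-f x)) g.riemVolume :=
    integrable_exp_neg_of_contMDiff hf
  have hfint : Integrable (fun x ↦ f x * Real.exp (-f x)) g.riemVolume :=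
    g.integrable_of_continuous (hf.continuous.mul (Real.continuous_exp.comp hf.continuous.neg))
  -- Green: `∫ Δ(e^{-f}) dV = 0`, and `Δ(e^{-f}) = (f − 2) e^{-f}`
  have h2 : ContMDiff (𝓡 4) 𝓘(ℝ, ℝ) 2 (fun y ↦ Real.exp (-f y)) :=
    ((Real.contDiff_exp.comp contDiff_neg).comp_contMDiff hf).of_le (WithTop.coe_le_coe.mpr le_top)
  have hpt : ∀ x, (f x - (finrank ℝ (EuclideanSpace ℝ (Fin 4)) : ℝ) / 2) * Real.exp (-f x) =
      f x * Real.exp (-f x) - 2 * Real.exp (-f x) := by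
    intro x
    rw [hE]
    push_cast
    ring
  have h0 := integral_dalembertian_riemVolume_eq_zero g hg h2
  simp_rw [h.dalembertian_exp_neg hf, hpt] at h0
  rw [integral_sub hfint (hint.const_mul 2), integral_const_mul] at h0
  linarith

/-- **STUB `stub_jensenVolumeBound` of line `cgy-variance-pivot` — the Jensen volume bound on a
closed normalised shrinker.** For `Ric + Hess f = g/2`, `R + |∇f|² = f`, smooth `f`, Riemannian
`g` (Levi-Civita) on a closed 4-manifold: `∫ e^{-f} dV ≤ e^{-2} · Vol(M,g)`. Proof:
`∫ f e^{-f} = 2 ∫ e^{-f}` (`integral_mul_exp_neg_eq_two_mul`: `Δ(e^{-f}) = (f − 2)e^{-f}`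
integrates to `0`), then the tangent line `(t − 1)e^{-t} ≤ e^{-2}` gives
`∫ e^{-f} = ∫ (f − 1) e^{-f} ≤ e^{-2} Vol` (`integral_exp_neg_le_of_mean_two`; the Riemannian
measure of a compact manifold is finite, `riemannianVolume_lt_top_of_isCompact_holds`). Equality
iff `f ≡ 2` (Einstein case); check: round `S⁴(√6)`, `f ≡ 2`, both sides `96π² e^{-2}`.
[cite: CaoHamiltonIlmanen2004, §4] [cite: CarrilloNi2009, §4] -/
theorem stub_jensenVolumeBound :
    ∀ (M : Type) [TopologicalSpace M] [T2Space M] [SecondCountableTopology M]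
      [ChartedSpace (EuclideanSpace ℝ (Fin 4)) M] [IsManifold (𝓡 4) ∞ M] [CompactSpace M]
      [T3Space M] [MeasurableSpace M] [BorelSpace M]
      (g : Literature.Geometry.Lorentzian.PseudoRiemannianMetric (𝓡 4) ∞ (EuclideanSpace ℝ (Fin 4))
        (TangentSpace (𝓡 4) : M → Type _)) [g.HasLeviCivita] (f : M → ℝ) (hg : g.IsRiemannian),
      ContMDiff (𝓡 4) 𝓘(ℝ, ℝ) ∞ f →
      (∀ (x : M) (X Y : TangentSpace (𝓡 4) x),
        g.ricci x X Y + g.hessian f x X Y = (1 / 2 : ℝ) * g.val x X Y) →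
      (∀ x : M, g.scalarCurvature x + g.gradSq f x = f x) →
      (∫ x, Real.exp (-f x)
          ∂(Literature.Geometry.Lorentzian.riemannianMeasure (g.toContMDiffRiemannianMetric hg))) ≤
        Real.exp (-2) *
          ((Literature.Geometry.Lorentzian.riemannianMeasure (g.toContMDiffRiemannianMetric hg))
            Set.univ).toReal := by
  intro M _ _ _ _ _ _ _ _ _ g _ f hg hf hsol hnorm
  have hid := integral_mul_exp_neg_eq_two_mul M g f hg hf hsol hnorm
  haveI : IsFiniteMeasure (riemannianMeasure (g.toContMDiffRiemannianMetric hg)) :=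
    ⟨riemannianVolume_lt_top_of_isCompact_holds (g.toContMDiffRiemannianMetric hg) le_rfl
      isCompact_univ⟩
  have hV : g.riemVolume = riemannianMeasure (g.toContMDiffRiemannianMetric hg) :=
    PseudoRiemannianMetric.riemVolume_eq hg
  have hint : Integrable (fun x ↦ Real.exp (-f x))
      (riemannianMeasure (g.toContMDiffRiemannianMetric hg)) :=
    hV ▸ integrable_exp_neg_of_contMDiff hf
  have hfint : Integrable (fun x ↦ f x * Real.exp (-f x))
      (riemannianMeasure (g.toContMDiffRiemannianMetric hg)) :=
    hV ▸ g.integrable_of_continuous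
      (hf.continuous.mul (Real.continuous_exp.comp hf.continuous.neg))
  exact integral_exp_neg_le_of_mean_two _ f hint hfint hid

/-- **Volume floor of a dense closed normalised shrinker** (by-product for the variance budget):
for `Ric + Hess f = g/2`, `R + |∇f|² = f`, smooth `f`, Riemannian `g` (Levi-Civita) on a closed
4-manifold, the crux's density hypothesis `32π²√π e^{-3/2} < ∫⁻ e^{-f} dV` (in its `lintegral`
form) forces `32π²√π e^{1/2} < Vol(M,g)` (`≈ 922.9`, i.e. `> 97.3 %` of `Vol S⁴(√6) = 96π²`):
`Z = ∫ e^{-f} dV ≤ e^{-2} Vol` (`stub_jensenVolumeBound` / `integral_exp_neg_le_of_mean_two`) and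
`Z > 32π²√π e^{-3/2}`. [cite: CaoHamiltonIlmanen2004, §4] -/
theorem volume_floor_of_density :
    ∀ (M : Type) [TopologicalSpace M] [T2Space M] [SecondCountableTopology M]
      [ChartedSpace (EuclideanSpace ℝ (Fin 4)) M] [IsManifold (𝓡 4) ∞ M] [CompactSpace M]
      [T3Space M] [MeasurableSpace M] [BorelSpace M]
      (g : Literature.Geometry.Lorentzian.PseudoRiemannianMetric (𝓡 4) ∞ (EuclideanSpace ℝ (Fin 4))
        (TangentSpace (𝓡 4) : M → Type _)) [g.HasLeviCivita] (f : M → ℝ) (hg : g.IsRiemannian),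
      ContMDiff (𝓡 4) 𝓘(ℝ, ℝ) ∞ f →
      (∀ (x : M) (X Y : TangentSpace (𝓡 4) x),
        g.ricci x X Y + g.hessian f x X Y = (1 / 2 : ℝ) * g.val x X Y) →
      (∀ x : M, g.scalarCurvature x + g.gradSq f x = f x) →
      ENNReal.ofReal (32 * Real.pi ^ 2 * Real.sqrt Real.pi * Real.exp (-(3 : ℝ) / 2)) <
        ∫⁻ x, ENNReal.ofReal (Real.exp (-f x))
          ∂(Literature.Geometry.Lorentzian.riemannianMeasure (g.toContMDiffRiemannianMetric hg)) →
      32 * Real.pi ^ 2 * Real.sqrt Real.pi * Real.exp (1 / 2) <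
        ((Literature.Geometry.Lorentzian.riemannianMeasure (g.toContMDiffRiemannianMetric hg))
            Set.univ).toReal := by
  intro M _ _ _ _ _ _ _ _ _ g _ f hg hf hsol hnorm hdens
  have hid := integral_mul_exp_neg_eq_two_mul M g f hg hf hsol hnorm
  haveI : IsFiniteMeasure (riemannianMeasure (g.toContMDiffRiemannianMetric hg)) :=
    ⟨riemannianVolume_lt_top_of_isCompact_holds (g.toContMDiffRiemannianMetric hg) le_rfl
      isCompact_univ⟩
  have hV : g.riemVolume = riemannianMeasure (g.toContMDiffRiemannianMetric hg) :=
    PseudoRiemannianMetric.riemVolume_eq hg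
  have hint : Integrable (fun x ↦ Real.exp (-f x))
      (riemannianMeasure (g.toContMDiffRiemannianMetric hg)) :=
    hV ▸ integrable_exp_neg_of_contMDiff hf
  have hfint : Integrable (fun x ↦ f x * Real.exp (-f x))
      (riemannianMeasure (g.toContMDiffRiemannianMetric hg)) :=
    hV ▸ g.integrable_of_continuous
      (hf.continuous.mul (Real.continuous_exp.comp hf.continuous.neg))
  exact volume_floor_of_mean_two _ f hint hfint hid hdens

end Summit.SmoothPoincare4.SmoothPoincare4.Theorems

end
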